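import Literature.Algebra.Homology.ExtOfProjectiveResolutionLinearMapPrecomp
import Literature.Algebra.Homology.ExtOfProjectiveResolutionDegreeZero
import HarnessLib

/-!
# `Extⁿ_R(M, N) ≃ₗ[R] Hⁿ(Hom_R(L•, N))` is natural in the resolved module `M` in EVERY degree (degree `0` and
# the all-degrees package); the two comparisons of two resolutions agree in every degree

Topic `Algebra/Homology`; namespace `Literature.Algebra.Homology.ModuleResolution`.  Theorems only (no definition,
no named fact, no instance, no notation, no `sorry`); imports the siblings `ExtOfProjectiveResolutionLinearMapPrecomp`
(lit-6 g8 H2: positive degrees, `complexMap`, `extLinearEquivHomH_precomp`,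
`homHEquivOfResolutions_eq_homHLinearEquivOfResolutions`) and `ExtOfProjectiveResolutionDegreeZero` (lit-6 g7 G2: degree
`0` of the engine `extZeroLinearEquivHomH`, the all-degrees package `extLinearEquivHomHOfDegree`).

For resolutions `L• —ε→ M`, `K• —η→ M'` given by linear maps, a chain map `f• : L• → K•` over `f' : M → M'`
(`η ∘ f₀ = f' ∘ ε`; e.g. the tree's `lift`, Weibel Comparison Theorem 2.2.6) and coefficients `N`:

* §1 **`extZeroLinearEquivHomH_precomp`**: `E⁰_L([f'] ∘ x') = homHComap N f hf 0 (E⁰_K x')` — degree `0` needs only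
  exactness at `L₀`, `K₀` and `ε`, `η` onto ([Weibel1994, Exercise 2.4.1, p. 43] «`L₀F(f) = F(f)` under the
  identification `L₀F(A) ≅ F(A)`», read for the contravariant `F = Hom_R(–, N)`: under `Ext⁰ = Hom` and
  `H⁰ = Hom(M, N)`, both sides are `x' ∘ f'`);
* §2 **`extLinearEquivHomHOfDegree_precomp`**: for every `n`,
  `Eⁿ_L([f'] ∘ x') = homHComap N f hf n (Eⁿ_K x')` ([Weibel1994, Lemma 2.4.4, p. 43] «the map `L_iF(f)` is `f̃_*`»
  for each `i`, with [Weibel1994, Thm. 2.7.6, p. 58]); `homHComap_eq_extLinearEquivHomHOfDegree_conj`;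
  `extLinearEquivHomHOfDegree_precomp_eq_homHComapOfMap` (the tree's canonical `homHComapOfMap … f' n` is
  `Extⁿ(f', N)` under the identifications, every `n`);
* §3 two projective resolutions of the same `M`: `homHComap_extLinearEquivHomHOfDegree_of_lifts_id` and
  **`homHEquivOfResolutions_eq_trans_extLinearEquivHomHOfDegree`**: in EVERY degree `n` the explicit comparison
  `ModuleResolution.homHEquivOfResolutions … n` (comap along any lift of `𝟙 M`, [Weibel1994, Lemma 2.4.1, p. 42]) is
  `(Eⁿ_K)⁻¹ ≫ Eⁿ_L`; in degree `n + 1` this is H2's `homHEquivOfResolutions_eq_homHLinearEquivOfResolutions`.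

Written by the literature-typing width seat lit-6 g8 (cell `pub-hsemireg`, tranche LT-H1); closes the
`TODO(general form)` «degree 0 … its naturality in M» of H2's docstring.  HONEST SCOPE: one universe `v`,
`[Small.{v} R]`; connecting homomorphisms not here.  Homological algebra only; nothing here bears on any summit.
Grade: REFEREED (textbook).  Mathlib ∕ tree searches: as in H2; nothing restated.

## References
* [Weibel1994] C. A. Weibel, *An introduction to homological algebra*, CUP (1994): Comparison Theorem 2.2.6 (p. 35),
  Lemma 2.4.1 (p. 42), Exercise 2.4.1 and Lemma 2.4.4 (p. 43), Thm. 2.7.6 (p. 58).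
-/

noncomputable section

universe v u

open CategoryTheory CategoryTheory.Limits CategoryTheory.Abelian

namespace Literature.Algebra.Homology

namespace ModuleResolution

variable {R : Type u} [CommRing R] [Small.{v} R]
  {L : ℕ → Type v} [∀ i, AddCommGroup (L i)] [∀ i, Module R (L i)]
  {K : ℕ → Type v} [∀ i, AddCommGroup (K i)] [∀ i, Module R (K i)]
  {d : ∀ i, L (i + 1) →ₗ[R] L i} {δ : ∀ i, K (i + 1) →ₗ[R] K i}
  {M M' : Type v} [AddCommGroup M] [Module R M] [AddCommGroup M'] [Module R M']
  {ε : L 0 →ₗ[R] M} {η : K 0 →ₗ[R] M'} (N : Type v) [AddCommGroup N] [Module R N]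

/-! ## §1 Degree `0` -/

section DegreeZero

variable (hL₀ : Function.Exact (d 0) ε) (hε : Function.Surjective ε)
  (hK₀ : Function.Exact (δ 0) η) (hη : Function.Surjective η)
  (f : ∀ i, L i →ₗ[R] K i) (hf : ∀ i, δ i ∘ₗ f (i + 1) = f i ∘ₗ d i) (f' : M →ₗ[R] M')
  (hf0 : η ∘ₗ f 0 = f' ∘ₗ ε)

include hf0 in
/-- **Naturality of `extZeroLinearEquivHomH` in the resolved module**: `E⁰_L([f'] ∘ x') = homHComap N f hf 0 (E⁰_K x')`
— both sides are the class of the cocycle `x' ∘ f' ∘ ε = x' ∘ η ∘ f₀ : L₀ → N` («`L₀F(f) = F(f)` under the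
identification `L₀F(A) ≅ F(A)`», contravariant `F = Hom_R(–, N)`). [cite: Weibel1994, Exercise 2.4.1 (p. 43); §2.5 (Example 2.5.3)] -/
theorem extZeroLinearEquivHomH_precomp (x' : Ext (ModuleCat.of R M') (ModuleCat.of R N) 0) :
    extZeroLinearEquivHomH N hL₀ hε ((Ext.mk₀ (ModuleCat.ofHom f')).comp x' (zero_add 0)) =
      homHComap N f hf 0 (extZeroLinearEquivHomH N hK₀ hη x') := by
  obtain ⟨φ, rfl⟩ : ∃ φ : M' →ₗ[R] N, x' = Ext.mk₀ (ModuleCat.ofHom φ) :=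
    ⟨extZeroLinearEquivHom M' N x', by rw [← extZeroLinearEquivHom_symm_apply, LinearEquiv.symm_apply_apply]⟩
  rw [Ext.mk₀_comp_mk₀, ← ModuleCat.ofHom_comp, extZeroLinearEquivHomH_mk₀, extZeroLinearEquivHomH_mk₀,
    homHComap_mk]
  congr 1
  apply Subtype.ext
  rw [homEquivHomCocyclesZero_apply, homCocyclesComap_apply_coe, homEquivHomCocyclesZero_apply,
    LinearMap.comp_assoc, LinearMap.comp_assoc, hf0]

end DegreeZero

/-! ## §2 Every degree -/

section AllDegrees

variable [∀ i, Module.Projective R (L i)] [∀ i, Module.Projective R (K i)]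
  (hL : ∀ i, Function.Exact (d (i + 1)) (d i)) (hL₀ : Function.Exact (d 0) ε) (hε : Function.Surjective ε)
  (hK : ∀ i, Function.Exact (δ (i + 1)) (δ i)) (hK₀ : Function.Exact (δ 0) η) (hη : Function.Surjective η)
  (f : ∀ i, L i →ₗ[R] K i) (hf : ∀ i, δ i ∘ₗ f (i + 1) = f i ∘ₗ d i) (f' : M →ₗ[R] M')
  (hf0 : η ∘ₗ f 0 = f' ∘ₗ ε)

include hf0 in
/-- **Naturality of `extLinearEquivHomHOfDegree` in the resolved module, every degree `n`**:
`Eⁿ_L([f'] ∘ x') = homHComap N f hf n (Eⁿ_K x')` — «there is a natural map `L_iF(f)` […] for each `i` […] The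
map `L_iF(f)` is `f̃_*`», contravariant `F = Hom_R(–, N)`, `Ext_R^n(A,B) ≅ R^n Hom_R(–,B)(A)`.
[cite: Weibel1994, Lemma 2.4.4 (p. 43); Theorem 2.7.6 (p. 58)] -/
theorem extLinearEquivHomHOfDegree_precomp :
    ∀ (n : ℕ) (x' : Ext (ModuleCat.of R M') (ModuleCat.of R N) n),
      extLinearEquivHomHOfDegree hL hL₀ hε N n ((Ext.mk₀ (ModuleCat.ofHom f')).comp x' (zero_add n)) =
        homHComap N f hf n (extLinearEquivHomHOfDegree hK hK₀ hη N n x')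
  | 0, x' => extZeroLinearEquivHomH_precomp N hL₀ hε hK₀ hη f hf f' hf0 x'
  | n + 1, x' => extLinearEquivHomH_precomp N hL hL₀ hε hK hK₀ hη f hf f' hf0 n x'

include hf0 in
/-- Inverse form, every degree: `Hⁿ(Hom_R(f•, N)) = Eⁿ_L ∘ Extⁿ(f', N) ∘ (Eⁿ_K)⁻¹`.
[cite: Weibel1994, Lemma 2.4.4 (p. 43); Theorem 2.7.6 (p. 58)] -/
theorem homHComap_eq_extLinearEquivHomHOfDegree_conj (n : ℕ) (y : HomH δ N n) :
    homHComap N f hf n y =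
      extLinearEquivHomHOfDegree hL hL₀ hε N n
        ((Ext.mk₀ (ModuleCat.ofHom f')).comp ((extLinearEquivHomHOfDegree hK hK₀ hη N n).symm y) (zero_add n)) := by
  rw [extLinearEquivHomHOfDegree_precomp N hL hL₀ hε hK hK₀ hη f hf f' hf0, LinearEquiv.apply_symm_apply]

/-- **The tree's canonical `homHComapOfMap … f' n` is `Extⁿ(f', N)` under the identifications, every degree `n`.**
[cite: Weibel1994, Lemma 2.4.1 (p. 42); Lemma 2.4.4 (p. 43)] -/
theorem extLinearEquivHomHOfDegree_precomp_eq_homHComapOfMap (n : ℕ)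
    (x' : Ext (ModuleCat.of R M') (ModuleCat.of R N) n) :
    extLinearEquivHomHOfDegree hL hL₀ hε N n ((Ext.mk₀ (ModuleCat.ofHom f')).comp x' (zero_add n)) =
      homHComapOfMap N (fun i => (hL i).linearMap_comp_eq_zero) hL₀.linearMap_comp_eq_zero hK hK₀ hη f' n
        (extLinearEquivHomHOfDegree hK hK₀ hη N n x') :=
  extLinearEquivHomHOfDegree_precomp N hL hL₀ hε hK hK₀ hη _
    (comm_lift (fun i => (hL i).linearMap_comp_eq_zero) hL₀.linearMap_comp_eq_zero hK hK₀ hη f') f'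
    (comm_lift_zero (fun i => (hL i).linearMap_comp_eq_zero) hL₀.linearMap_comp_eq_zero hK hK₀ hη f') n x'

end AllDegrees

/-! ## §3 Two projective resolutions of the same module, every degree -/

section SameModule

variable [∀ i, Module.Projective R (L i)] [∀ i, Module.Projective R (K i)] {η : K 0 →ₗ[R] M}
  (hL : ∀ i, Function.Exact (d (i + 1)) (d i)) (hL₀ : Function.Exact (d 0) ε) (hε : Function.Surjective ε)
  (hK : ∀ i, Function.Exact (δ (i + 1)) (δ i)) (hK₀ : Function.Exact (δ 0) η) (hη : Function.Surjective η)

/-- A chain map `g• : L• → K•` over `𝟙 M` induces `Eⁿ_L ∘ (Eⁿ_K)⁻¹` in every degree.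
[cite: Weibel1994, Lemma 2.4.1 (p. 42)] -/
theorem homHComap_extLinearEquivHomHOfDegree_of_lifts_id {g : ∀ i, L i →ₗ[R] K i}
    (hg : ∀ i, δ i ∘ₗ g (i + 1) = g i ∘ₗ d i) (hg0 : η ∘ₗ g 0 = ε) (n : ℕ)
    (x : Ext (ModuleCat.of R M) (ModuleCat.of R N) n) :
    homHComap N g hg n (extLinearEquivHomHOfDegree hK hK₀ hη N n x) = extLinearEquivHomHOfDegree hL hL₀ hε N n x := by
  rw [← extLinearEquivHomHOfDegree_precomp N hL hL₀ hε hK hK₀ hη g hg LinearMap.id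
      (hg0.trans (LinearMap.id_comp _).symm), ModuleCat.ofHom_id, Ext.mk₀_id_comp]

/-- **In every degree the explicit comparison of two projective resolutions is `(Eⁿ_K)⁻¹ ≫ Eⁿ_L`**, pointwise.
[cite: Weibel1994, Lemma 2.4.1 (p. 42); Theorem 2.7.6 (p. 58)] -/
theorem homHEquivOfResolutions_apply_eq_of_degree (n : ℕ) (y : HomH δ N n) :
    homHEquivOfResolutions hL hL₀ hε hK hK₀ hη n y =
      extLinearEquivHomHOfDegree hL hL₀ hε N n ((extLinearEquivHomHOfDegree hK hK₀ hη N n).symm y) := by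
  obtain ⟨x, rfl⟩ := (extLinearEquivHomHOfDegree hK hK₀ hη N n).surjective y
  have hg0 : η ∘ₗ lift d δ ε η (fun i => (hL i).linearMap_comp_eq_zero) hL₀.linearMap_comp_eq_zero hK hK₀ hη
      LinearMap.id 0 = ε :=
    (comm_lift_zero (fun i => (hL i).linearMap_comp_eq_zero) hL₀.linearMap_comp_eq_zero hK hK₀ hη
      LinearMap.id).trans (LinearMap.id_comp _)
  rw [homHEquivOfResolutions_eq_homHComap hL hL₀ hε hK hK₀ hη n
      (comm_lift (fun i => (hL i).linearMap_comp_eq_zero) hL₀.linearMap_comp_eq_zero hK hK₀ hη LinearMap.id)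
      hg0,
    homHComap_extLinearEquivHomHOfDegree_of_lifts_id N hL hL₀ hε hK hK₀ hη _ hg0, LinearEquiv.symm_apply_apply]

/-- **`homHEquivOfResolutions … n = (Eⁿ_K)⁻¹ ≫ Eⁿ_L` as `R`-linear isomorphisms, every degree `n`** (degree
`n + 1`: H2's `homHEquivOfResolutions_eq_homHLinearEquivOfResolutions`; degree `0` new).
[cite: Weibel1994, Lemma 2.4.1 (p. 42); Theorem 2.7.6 (p. 58)] -/
theorem homHEquivOfResolutions_eq_trans_extLinearEquivHomHOfDegree (n : ℕ) :
    homHEquivOfResolutions (N := N) hL hL₀ hε hK hK₀ hη n =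
      (extLinearEquivHomHOfDegree hK hK₀ hη N n).symm.trans (extLinearEquivHomHOfDegree hL hL₀ hε N n) :=
  LinearEquiv.ext fun y => homHEquivOfResolutions_apply_eq_of_degree N hL hL₀ hε hK hK₀ hη n y

end SameModule

end ModuleResolution

end Literature.Algebra.Homology
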